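import Summits.QuantumFields.YangMills.Theorems.SwapVirialDeficitBlowUpVirialZLetterShare
import Summits.QuantumFields.YangMills.Theorems.SwapVirialDeficitSwapRingDeficitMoments
import HarnessLib

/-!
# Chart functionals dominated by a POWER of the deficit: the socket `K_L⟪g⟫_{z,b} ≤ c·∫ F_z^p e^{−bF_z} dμ_L`, its window-uniform a-priori form,
# (free-hands support of ⟨stmt-QuantumFields-24197⟩ `SwapVirialDeficit.SwapGluedStiffness`)

The residue (LW) of the virial route (fcl-p3 g46 memo2 §3, w2 g57 memo3 (C1)) is a sum of chart functionals
`K_L⟪g⟫_{z,b} = K_L·∫_cone Σ_ε ∫_η g·e^{−b F̂_{z,a,ε}}·ρ` whose integrands are POINTWISE dominated by a power of the deficit off the null hub: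
`g ≤ c·F̂^p` (`p = 1`: the followers' and the `z`-letter's Euler weights ✓`followersW_le_gnoDeficit`, ✓`gnomonicW_z_le`, and the hub-soft letters ON GOOD HUBS
by ✓`hubStiff_mul_gnoWtr_x_le` ∕ ✓`hubStiff_mul_gnoWtr_y_le`; `p = 3/2`: cubic Taylor remainders).  This file proves the socket ONCE, for every `p > 0`, and feeds
it with the window-uniform moment bounds of ✓`…SwapRingDeficitMoments`:

* §1 ★ `integral_rpow_swapDeficit_exp_eq_gnomonic` — the dictionary `∫ F_z^p e^{−bF_z} dμ_L = K_L·∫_cone Σ_ε ∫ F̂^p e^{−bF̂} ρ` (w2's Bochner chart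
  ✓`integral_ringMeasure_eq_gnomonic`), `gnoDeficit_le_bound`;
* §2 ★★ `chartTerm_le_of_le_mul_rpow_deficit` — for jointly measurable bounded `g ε : ℍ × GnoCoord L → ℝ` with `g ε (a,η) ≤ c·F̂_{z,a,ε}(η)^p` for `a ≠ 0`:
  `K_L·∫_cone Σ_ε ∫ g·e^{−bF̂}ρ ≤ c·∫ F_z^p e^{−bF_z} dμ_L`; `p = 1` form ★ `chartTerm_le_meanDeficit_of_le_mul_deficit` (`≤ c·E_z(b)`; subsumes the shape of
  ✓`followersW_term_le_meanDeficit`, ✓`zW_term_le_meanDeficit`);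
* §3 (principal sector, window-uniform) ★★★ `chartTerm_rpow_apriori` — ABSOLUTE `C, β₁`: `K_L⟪g⟫₀ ≤ c·e·(C·p·L⁴(1 + log L + log b)/b)^p·Z₀(b)` for every such `g`,
  every `L`, `b ≥ β₁`, `p > 0` (✓`swap_deficit_rpow_moment_le`); ★★ `chartTerm_threeHalves_apriori` (`b·K_L⟪g⟫₀ ≤ c·C·(L⁴ℓ)^{3/2}·b^{−1/2}·Z₀(b)`);
The good-hub instances (powers of the hub-soft leaders' weights) are in the companion `…BlowUpVirialGoodHubPowers`.  What is NOT here: the BAD hubs (the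
hub-mass small ball (HM), by fcl-p3 g46 memo3 a one-loop-uniformity statement), the valley structure of `R`, the third-order S-B bound — i.e. (LW) itself.

HONEST LABEL: sockets and crude window-uniform bookkeeping for the DRAFT virial line; (LW) ∕ (M) ∕ ⟨24197⟩ (window-uniform) ∕ ⟨24194⟩ ∕ ⟨24196⟩ ∕ ⟨24497⟩ OPEN;
own crux ⟨22884⟩ OPEN (blocked-on ⟨19935⟩); no crux, rung of record or summit is proved; the Yang–Mills mass gap is NOT proved; no summit is proved by a line.
THEOREMS ONLY (0 `def`, 0 `sorry`), standard axioms; the series' local `ℍ` instances (`coneMeasure` lives on `ℍ`).  Width seat ym-line-sfw-p2-w3 g65 (cell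
ym-idea-1, free hands), `--supports stmt-QuantumFields-24197`.  References: [cite: Luscher1983, §2]; [cite: Griffiths1964]; [cite: tHooft1979]; [folklore].
-/

set_option autoImplicit false
set_option synthInstance.maxSize 1024

noncomputable section

open MeasureTheory Quaternion Set Filter Topology
open scoped Quaternion BigOperators
open Literature.MathematicalPhysics.QuantumLattice
open Literature.MathematicalPhysics.QuantumFieldTheory hiding SU2
open Summit.QuantumFields.YangMills.Theorems.FemtoTransferGap
open Summit.QuantumFields.YangMills.Theorems.FemtoTransferGap.TT
open Summit.QuantumFields.YangMills.Theorems.VirialFluxGap.RingDeficit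
open Summit.QuantumFields.YangMills.Theorems.SwapTwistDeficit.ToronLog (coneMeasure coneConst coneConst_pos isProbabilityMeasure_coneMeasure)
open Summit.QuantumFields.YangMills.Theorems.SwapVirialDeficit.SwapRing
open Summit.QuantumFields.YangMills.Theorems.SwapVirialDeficit.Gnomonic (gnomonicW gnomonicW_nonneg_le)
open Summit.QuantumFields.YangMills.Theorems.SwapVirialDeficit.ZeroModeSigma (ae_ne_zero_coneMeasure)

attribute [local instance] Literature.Analysis.FluidPDE.Tao2016.quatMeasurableSpace
  Literature.Analysis.FluidPDE.Tao2016.quatBorelSpace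
  Literature.MathematicalPhysics.QuantumLattice.secondCountableTopology_su2

namespace Summit.QuantumFields.YangMills.Theorems.SwapVirialDeficit.BlowUpRing

variable {L : ℕ} [NeZero L]

/-! ## §1 The dictionary for powers of the deficit -/

/-- A uniform bound of the ring deficit bounds the chart deficit: `|F_z| ≤ B` on the ring ⟹ `F̂_{z,a,ε}(η) ≤ B` (the chart deficit IS the ring deficit of
the charted history). [folklore] -/
theorem gnoDeficit_le_bound (z : Fin 3 → Bool) {B : ℝ}
    (hB : ∀ q : (Fin (2 * L - 1 + 1) → GaugeConfig 3 L SU2) × (Site 3 L → SU2), |swapRingDeficit L z q| ≤ B) (a : ℍ) (ε : GnoSign L) (η : GnoCoord L) :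
    gnoDeficit z (fun _ => 1) a ε η ≤ B :=
  (le_abs_self _).trans (hB _)

/-- The `F̂^p`-fibre integrand `F̂^p e^{−bF̂} ρ` is integrable (`b ≥ 0`, `p > 0`; bounded by `B^p ρ`). [folklore] -/
theorem integrable_rpow_gnoDeficit_fibre (z : Fin 3 → Bool) (a : ℍ) (ε : GnoSign L) {b p : ℝ} (hb : 0 ≤ b) (hp : 0 < p) :
    Integrable fun η : GnoCoord L =>
      gnoDeficit z (fun _ => 1) a ε η ^ p * Real.exp (-(b * gnoDeficit z (fun _ => 1) a ε η)) * gnoDensity η := by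
  obtain ⟨B, hB⟩ := exists_abs_swapRingDeficit_le (L := L) z
  refine (integrable_gnoDensity.const_mul (B ^ p)).mono'
    ((((measurable_gnoDeficit z _ a ε).pow_const p).mul (((measurable_gnoDeficit z _ a ε).const_mul b).neg.exp)).mul
      measurable_gnoDensity).aestronglyMeasurable (ae_of_all _ fun η => ?_)
  have h0 := gnoDeficit_nonneg z (fun _ => (1 : SU2)) a ε η
  have h1 := abs_exp_gnoDeficit_le_one z (fun _ => (1 : SU2)) a ε hb η
  rw [Real.norm_eq_abs, abs_mul, abs_mul, abs_of_nonneg (Real.rpow_nonneg h0 _), abs_of_pos (gnoDensity_pos η)]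
  calc gnoDeficit z (fun _ => 1) a ε η ^ p * |Real.exp (-(b * gnoDeficit z (fun _ => 1) a ε η))| * gnoDensity η ≤ B ^ p * 1 * gnoDensity η :=
        mul_le_mul_of_nonneg_right (mul_le_mul (Real.rpow_le_rpow h0 (gnoDeficit_le_bound z hB a ε η) hp.le) h1 (abs_nonneg _)
          (Real.rpow_nonneg (h0.trans (gnoDeficit_le_bound z hB a ε η)) _)) (gnoDensity_pos η).le
    _ = B ^ p * gnoDensity η := by rw [mul_one]

/-- ★ **DICTIONARY FOR POWERS**: for every sector `z`, `b ≥ 0` and `p > 0`,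
`∫ F_z^p e^{−bF_z} dμ_L = K_L · ∫_cone Σ_ε ∫ F̂^p e^{−bF̂} ρ` (✓`integral_ringMeasure_eq_gnomonic` for the bounded seam-invariant `G = F^p e^{−bF}`).
[cite: tHooft1979] [cite: Luscher1983, §2] -/
theorem integral_rpow_swapDeficit_exp_eq_gnomonic (z : Fin 3 → Bool) {b p : ℝ} (hb : 0 ≤ b) (hp : 0 < p) :
    ∫ q, swapRingDeficit L z q ^ p * Real.exp (-(b * swapRingDeficit L z q)) ∂(ringMeasure L) =
      (coneConst ^ 3 / 64 * (1 / (2 * Real.pi ^ 2)) ^ Fintype.card (Fol L)) *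
        ∫ a, (∑ ε : GnoSign L, ∫ η : GnoCoord L,
          gnoDeficit z (fun _ => 1) a ε η ^ p * Real.exp (-(b * gnoDeficit z (fun _ => 1) a ε η)) * gnoDensity η) ∂coneMeasure := by
  obtain ⟨B, hB⟩ := exists_abs_swapRingDeficit_le (L := L) z
  have hB0 : 0 ≤ B := (abs_nonneg _).trans (hB (Classical.arbitrary _))
  have h := integral_ringMeasure_eq_gnomonic (L := L) (⇑(sitePerm (L := L) (Equiv.swap (0 : Fin 3) 1))) (χ := fun _ => 1) one_central
    (G := fun q => swapRingDeficit L z q ^ p * Real.exp (-(b * swapRingDeficit L z q)))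
    (((measurable_swapRingDeficit z).pow_const p).mul ((measurable_swapRingDeficit z).const_mul b).neg.exp) (M := B ^ p)
    (fun q => by
      have h0 := swapRingDeficit_nonneg (L := L) z q
      rw [abs_mul, abs_of_pos (Real.exp_pos _), abs_of_nonneg (Real.rpow_nonneg h0 _)]
      have h1 : Real.exp (-(b * swapRingDeficit L z q)) ≤ 1 := Real.exp_le_one_iff.2 (by nlinarith)
      calc swapRingDeficit L z q ^ p * Real.exp (-(b * swapRingDeficit L z q)) ≤ B ^ p * 1 :=
            mul_le_mul (Real.rpow_le_rpow h0 ((le_abs_self _).trans (hB q)) hp.le) h1 (Real.exp_pos _).le (Real.rpow_nonneg hB0 _)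
        _ = B ^ p := mul_one _)
    (fun h q => by simp only [swapRingDeficit_seamGaugeAct])
  rw [h]
  rfl

/-! ## §2 The socket: chart functionals dominated pointwise by `c·F̂^p` off the null hub -/

section Socket

variable (z : Fin 3 → Bool) {b p c M : ℝ}

/-- Fibrewise socket: `g ≤ c·F̂^p` pointwise on the fibre (`g` measurable, `|g| ≤ M`) ⟹ `∫ g e^{−bF̂}ρ ≤ c·∫ F̂^p e^{−bF̂}ρ`. [folklore] -/
theorem fibre_le_of_le_mul_rpow (a : ℍ) (ε : GnoSign L) {g : GnoCoord L → ℝ} (hgm : Measurable g) (hbd : ∀ η, |g η| ≤ M)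
    (hle : ∀ η, g η ≤ c * gnoDeficit z (fun _ => 1) a ε η ^ p) (hb : 0 ≤ b) (hp : 0 < p) :
    ∫ η : GnoCoord L, g η * Real.exp (-(b * gnoDeficit z (fun _ => 1) a ε η)) * gnoDensity η ≤
      c * ∫ η : GnoCoord L, gnoDeficit z (fun _ => 1) a ε η ^ p * Real.exp (-(b * gnoDeficit z (fun _ => 1) a ε η)) * gnoDensity η := by
  rw [← integral_const_mul]
  have hM : 0 ≤ M := (abs_nonneg _).trans (hbd (Classical.arbitrary _))
  have hig : Integrable (fun η : GnoCoord L => g η * Real.exp (-(b * gnoDeficit z (fun _ => 1) a ε η)) * gnoDensity η) := by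
    refine (integrable_gnoDensity.const_mul M).mono'
      ((hgm.mul (((measurable_gnoDeficit z _ a ε).const_mul b).neg.exp)).mul measurable_gnoDensity).aestronglyMeasurable (ae_of_all _ fun η => ?_)
    rw [Real.norm_eq_abs, abs_mul, abs_mul, abs_of_pos (gnoDensity_pos η)]
    have h1 := abs_exp_gnoDeficit_le_one z (fun _ => (1 : SU2)) a ε hb η
    calc |g η| * |Real.exp (-(b * gnoDeficit z (fun _ => 1) a ε η))| * gnoDensity η ≤ M * 1 * gnoDensity η :=
          mul_le_mul_of_nonneg_right (mul_le_mul (hbd η) h1 (abs_nonneg _) hM) (gnoDensity_pos η).le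
      _ = M * gnoDensity η := by rw [mul_one]
  refine integral_mono hig ((integrable_rpow_gnoDeficit_fibre z a ε hb hp).const_mul c) fun η => ?_
  have hE := (Real.exp_pos (-(b * gnoDeficit z (fun _ => (1 : SU2)) a ε η))).le
  have hρ := (gnoDensity_pos η).le
  show g η * Real.exp (-(b * gnoDeficit z (fun _ => 1) a ε η)) * gnoDensity η ≤
    c * (gnoDeficit z (fun _ => 1) a ε η ^ p * Real.exp (-(b * gnoDeficit z (fun _ => 1) a ε η)) * gnoDensity η)
  rw [show c * (gnoDeficit z (fun _ => 1) a ε η ^ p * Real.exp (-(b * gnoDeficit z (fun _ => 1) a ε η)) * gnoDensity η) =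
      (c * gnoDeficit z (fun _ => 1) a ε η ^ p) * Real.exp (-(b * gnoDeficit z (fun _ => 1) a ε η)) * gnoDensity η by ring]
  exact mul_le_mul_of_nonneg_right (mul_le_mul_of_nonneg_right (hle η) hE) hρ

/-- The `F̂^p` functional `a ↦ Σ_ε ∫ F̂^p e^{−bF̂}ρ` is cone-integrable (`b ≥ 0`, `p > 0`). [folklore] -/
theorem integrable_fibre_rpow_gnoDeficit (hb : 0 ≤ b) (hp : 0 < p) :
    Integrable (fun a : ℍ => ∑ ε : GnoSign L, ∫ η : GnoCoord L,
      gnoDeficit z (fun _ => 1) a ε η ^ p * Real.exp (-(b * gnoDeficit z (fun _ => 1) a ε η)) * gnoDensity η) coneMeasure := by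
  obtain ⟨B, hB⟩ := exists_abs_swapRingDeficit_le (L := L) z
  exact integrable_sum_fibre z (fun _ => 1) (g := fun ε q => gnoDeficit z (fun _ => 1) q.1 ε q.2 ^ p)
    (fun ε => ((measurable_gnoDeficit_uncurry z _ ε).pow_const p).aemeasurable) (M := B ^ p)
    (fun ε q => by
      have h0 := gnoDeficit_nonneg z (fun _ => (1 : SU2)) q.1 ε q.2
      rw [abs_of_nonneg (Real.rpow_nonneg h0 _)]
      exact Real.rpow_le_rpow h0 (gnoDeficit_le_bound z hB q.1 ε q.2) hp.le) hb

/-- ★★ **THE SOCKET**: let `g ε : ℍ × GnoCoord L → ℝ` be jointly measurable and bounded (`|g| ≤ M`), with `g ε (a, η) ≤ c·F̂_{z,a,ε}(η)^p` for every hub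
`a ≠ 0` (`p > 0`, `b ≥ 0`; any real `c`).  Then
`K_L · ∫_cone Σ_ε ∫ g·e^{−bF̂}·ρ ≤ c · ∫ F_z^p e^{−bF_z} dμ_L`
(fibrewise domination, `a ≠ 0` cone-a.e. ✓`ae_ne_zero_coneMeasure`, and the dictionary `integral_rpow_swapDeficit_exp_eq_gnomonic`). [cite: Luscher1983, §2] -/
theorem chartTerm_le_of_le_mul_rpow_deficit {g : GnoSign L → ℍ × GnoCoord L → ℝ} (hg : ∀ ε, Measurable (g ε)) (hbd : ∀ ε q, |g ε q| ≤ M)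
    (hle : ∀ (ε : GnoSign L) (a : ℍ) (η : GnoCoord L), a ≠ 0 → g ε (a, η) ≤ c * gnoDeficit z (fun _ => 1) a ε η ^ p)
    (hb : 0 ≤ b) (hp : 0 < p) :
    (coneConst ^ 3 / 64 * (1 / (2 * Real.pi ^ 2)) ^ Fintype.card (Fol L)) *
        ∫ a, (∑ ε : GnoSign L, ∫ η : GnoCoord L, g ε (a, η) * Real.exp (-(b * gnoDeficit z (fun _ => 1) a ε η)) * gnoDensity η) ∂coneMeasure ≤
      c * ∫ q, swapRingDeficit L z q ^ p * Real.exp (-(b * swapRingDeficit L z q)) ∂(ringMeasure L) := by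
  rw [integral_rpow_swapDeficit_exp_eq_gnomonic z hb hp]
  have hK : (0 : ℝ) ≤ coneConst ^ 3 / 64 * (1 / (2 * Real.pi ^ 2)) ^ Fintype.card (Fol L) := by have := coneConst_pos; positivity
  have hmono : ∫ a, (∑ ε : GnoSign L, ∫ η : GnoCoord L, g ε (a, η) * Real.exp (-(b * gnoDeficit z (fun _ => 1) a ε η)) * gnoDensity η) ∂coneMeasure ≤
      ∫ a, (c * ∑ ε : GnoSign L, ∫ η : GnoCoord L,
        gnoDeficit z (fun _ => 1) a ε η ^ p * Real.exp (-(b * gnoDeficit z (fun _ => 1) a ε η)) * gnoDensity η) ∂coneMeasure := by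
    refine integral_mono_ae (integrable_sum_fibre z (fun _ => 1) (fun ε => (hg ε).aemeasurable) hbd hb)
      ((integrable_fibre_rpow_gnoDeficit z hb hp).const_mul c) ?_
    filter_upwards [ae_ne_zero_coneMeasure] with a ha
    show (∑ ε : GnoSign L, ∫ η : GnoCoord L, g ε (a, η) * Real.exp (-(b * gnoDeficit z (fun _ => 1) a ε η)) * gnoDensity η) ≤
      c * ∑ ε : GnoSign L, ∫ η : GnoCoord L,
        gnoDeficit z (fun _ => 1) a ε η ^ p * Real.exp (-(b * gnoDeficit z (fun _ => 1) a ε η)) * gnoDensity η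
    rw [Finset.mul_sum]
    exact Finset.sum_le_sum fun ε _ =>
      fibre_le_of_le_mul_rpow z a ε (g := fun η => g ε (a, η)) ((hg ε).comp (measurable_const.prodMk measurable_id))
        (fun η => hbd ε (a, η)) (fun η => hle ε a η ha) hb hp
  rw [integral_const_mul] at hmono
  calc _ ≤ (coneConst ^ 3 / 64 * (1 / (2 * Real.pi ^ 2)) ^ Fintype.card (Fol L)) * (c * ∫ a, (∑ ε : GnoSign L, ∫ η : GnoCoord L,
          gnoDeficit z (fun _ => 1) a ε η ^ p * Real.exp (-(b * gnoDeficit z (fun _ => 1) a ε η)) * gnoDensity η) ∂coneMeasure) :=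
        mul_le_mul_of_nonneg_left hmono hK
    _ = _ := by ring

/-- ★ **THE SOCKET, `p = 1`**: `g ε (a, η) ≤ c·F̂` for `a ≠ 0` ⟹ `K_L·∫_cone Σ_ε ∫ g·e^{−bF̂}ρ ≤ c·E_z(b)`, `E_z(b) = ∫ F_z e^{−bF_z} dμ_L`
(the common shape of ✓`followersW_term_le_meanDeficit` and ✓`zW_term_le_meanDeficit`). [cite: Luscher1983, §2] -/
theorem chartTerm_le_meanDeficit_of_le_mul_deficit {g : GnoSign L → ℍ × GnoCoord L → ℝ} (hg : ∀ ε, Measurable (g ε)) (hbd : ∀ ε q, |g ε q| ≤ M)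
    (hle : ∀ (ε : GnoSign L) (a : ℍ) (η : GnoCoord L), a ≠ 0 → g ε (a, η) ≤ c * gnoDeficit z (fun _ => 1) a ε η) (hb : 0 ≤ b) :
    (coneConst ^ 3 / 64 * (1 / (2 * Real.pi ^ 2)) ^ Fintype.card (Fol L)) *
        ∫ a, (∑ ε : GnoSign L, ∫ η : GnoCoord L, g ε (a, η) * Real.exp (-(b * gnoDeficit z (fun _ => 1) a ε η)) * gnoDensity η) ∂coneMeasure ≤
      c * ∫ q, swapRingDeficit L z q * Real.exp (-(b * swapRingDeficit L z q)) ∂(ringMeasure L) := by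
  have h := chartTerm_le_of_le_mul_rpow_deficit z (p := 1) hg hbd (fun ε a η ha => by rw [Real.rpow_one]; exact hle ε a η ha) hb one_pos
  simpa only [Real.rpow_one] using h

end Socket

/-! ## §3 Principal sector: the socket fed with the window-uniform moment bounds -/

/-- ★★★ **CHART FUNCTIONALS DOMINATED BY `c·F̂^p` ARE `O((L⁴ log b/b)^p)·Z₀`, UNIFORMLY IN `L`**: there are ABSOLUTE `C > 0`, `β₁ ≥ 1` such that for
EVERY `L ≥ 1`, `b ≥ β₁`, `p > 0`, `c ≥ 0` and every jointly measurable bounded `g` with `g ε (a, η) ≤ c·F̂₀(a,ε,η)^p` off the null hub,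
`K_L·∫_cone Σ_ε ∫ g·e^{−bF̂₀}ρ ≤ c · e · (C·p·L⁴·(1 + log L + log b)/b)^p · Z₀(b)`,  `Z₀(b) = ∫ e^{−bF^S_0} dμ_L`
(the socket + ✓`swap_deficit_rpow_moment_le`). [cite: Griffiths1964] [cite: Luscher1983, §2] -/
theorem chartTerm_rpow_apriori :
    ∃ C : ℝ, 0 < C ∧ ∃ β₁ : ℝ, 1 ≤ β₁ ∧ ∀ (L : ℕ) [NeZero L] (b : ℝ), β₁ ≤ b → ∀ (p : ℝ), 0 < p → ∀ (c : ℝ), 0 ≤ c → ∀ (M : ℝ)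
      (g : GnoSign L → ℍ × GnoCoord L → ℝ), (∀ ε, Measurable (g ε)) → (∀ ε q, |g ε q| ≤ M) →
      (∀ (ε : GnoSign L) (a : ℍ) (η : GnoCoord L), a ≠ 0 → g ε (a, η) ≤ c * gnoDeficit (fun _ => false) (fun _ => 1) a ε η ^ p) →
      (coneConst ^ 3 / 64 * (1 / (2 * Real.pi ^ 2)) ^ Fintype.card (Fol L)) *
          ∫ a, (∑ ε : GnoSign L, ∫ η : GnoCoord L,
            g ε (a, η) * Real.exp (-(b * gnoDeficit (fun _ => false) (fun _ => 1) a ε η)) * gnoDensity η) ∂coneMeasure ≤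
        c * (Real.exp 1 * (C * p * (L : ℝ) ^ 4 * (1 + Real.log L + Real.log b) / b) ^ p) *
          ∫ q, Real.exp (-(b * swapRingDeficit L (fun _ => false) q)) ∂(ringMeasure L) := by
  obtain ⟨C, hC, β₁, hβ₁, hmom⟩ := swap_deficit_rpow_moment_le
  refine ⟨C, hC, β₁, hβ₁, fun L _ b hb p hp c hc M g hg hbd hle => ?_⟩
  have hb0 : 0 ≤ b := by linarith
  have h1 := chartTerm_le_of_le_mul_rpow_deficit (fun _ => false) hg hbd hle hb0 hp
  have h2 := hmom L b hb p hp
  have e1 : ∀ q, Real.exp (-b * swapRingDeficit L (fun _ => false) q) = Real.exp (-(b * swapRingDeficit L (fun _ => false) q)) := fun q => by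
    rw [neg_mul]
  simp only [e1] at h2
  exact h1.trans (by nlinarith [mul_le_mul_of_nonneg_left h2 hc])

/-- ★★ **`p = 3/2` WITH THE COUPLING IN FRONT**: ABSOLUTE `C > 0`, `β₁ ≥ 1` such that for EVERY `L`, `b ≥ β₁`, `c ≥ 0` and every jointly measurable bounded
`g` with `g ε (a, η) ≤ c·F̂₀^{3/2}` off the null hub,
`b · K_L·∫_cone Σ_ε ∫ g·e^{−bF̂₀}ρ ≤ c · C · (L⁴·(1 + log L + log b))^{3/2} · b^{−1/2} · Z₀(b)` (✓`swap_deficit_threeHalves_moment_le`): a cubic Taylor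
remainder with polynomial constant contributes `o(1)·Z₀` to `β·K_L⟪R⟫₀` on any window. [cite: Griffiths1964] [cite: Luscher1983, §2] -/
theorem chartTerm_threeHalves_apriori :
    ∃ C : ℝ, 0 < C ∧ ∃ β₁ : ℝ, 1 ≤ β₁ ∧ ∀ (L : ℕ) [NeZero L] (b : ℝ), β₁ ≤ b → ∀ (c : ℝ), 0 ≤ c → ∀ (M : ℝ)
      (g : GnoSign L → ℍ × GnoCoord L → ℝ), (∀ ε, Measurable (g ε)) → (∀ ε q, |g ε q| ≤ M) →
      (∀ (ε : GnoSign L) (a : ℍ) (η : GnoCoord L), a ≠ 0 →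
        g ε (a, η) ≤ c * gnoDeficit (fun _ => false) (fun _ => 1) a ε η ^ ((3 : ℝ) / 2)) →
      b * ((coneConst ^ 3 / 64 * (1 / (2 * Real.pi ^ 2)) ^ Fintype.card (Fol L)) *
          ∫ a, (∑ ε : GnoSign L, ∫ η : GnoCoord L,
            g ε (a, η) * Real.exp (-(b * gnoDeficit (fun _ => false) (fun _ => 1) a ε η)) * gnoDensity η) ∂coneMeasure) ≤
        c * (C * ((L : ℝ) ^ 4 * (1 + Real.log L + Real.log b)) ^ ((3 : ℝ) / 2) * b ^ (-(1 : ℝ) / 2)) *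
          ∫ q, Real.exp (-(b * swapRingDeficit L (fun _ => false) q)) ∂(ringMeasure L) := by
  obtain ⟨C, hC, β₁, hβ₁, hmom⟩ := swap_deficit_threeHalves_moment_le
  refine ⟨C, hC, β₁, hβ₁, fun L _ b hb c hc M g hg hbd hle => ?_⟩
  have hb0 : 0 ≤ b := by linarith
  have h1 := chartTerm_le_of_le_mul_rpow_deficit (fun _ => false) hg hbd hle hb0 (by norm_num : (0 : ℝ) < 3 / 2)
  have h2 := hmom L b hb
  have e1 : ∀ q, Real.exp (-b * swapRingDeficit L (fun _ => false) q) = Real.exp (-(b * swapRingDeficit L (fun _ => false) q)) := fun q => by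
    rw [neg_mul]
  simp only [e1] at h2
  have h3 := mul_le_mul_of_nonneg_left h1 hb0
  calc _ ≤ b * (c * ∫ q, swapRingDeficit L (fun _ => false) q ^ ((3 : ℝ) / 2) * Real.exp (-(b * swapRingDeficit L (fun _ => false) q))
          ∂(ringMeasure L)) := h3
    _ = c * (b * ∫ q, swapRingDeficit L (fun _ => false) q ^ ((3 : ℝ) / 2) * Real.exp (-(b * swapRingDeficit L (fun _ => false) q))
          ∂(ringMeasure L)) := by ring
    _ ≤ c * (C * ((L : ℝ) ^ 4 * (1 + Real.log L + Real.log b)) ^ ((3 : ℝ) / 2) * b ^ (-(1 : ℝ) / 2) *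
          ∫ q, Real.exp (-(b * swapRingDeficit L (fun _ => false) q)) ∂(ringMeasure L)) := mul_le_mul_of_nonneg_left h2 hc
    _ = _ := by ring

end Summit.QuantumFields.YangMills.Theorems.SwapVirialDeficit.BlowUpRing

end
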